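import Summits.KontsevichZagierPeriods.Zeta5Search.TwoTaleOmega.StepBL
import Summits.KontsevichZagierPeriods.Zeta5Search.Certificates.TwoTaleTelescopeGL

/-!
# (bmiss)@Ω — the recurrence in direction `g`, FIRST TALE (cell `pub-zeta5`, fam-tele gen 5, on cert-1's `StepBL` template)

HONEST FRAMING: systematic search; recurrence certificates; no irrationality claim unless certified. Pure finite algebra
over `ℚ`; no named fact, no `sorry`. Nothing here is about the value of `ζ(2)` or `ζ(5)`.

Blueprint `families/tele/RECURRENCE.md` §13.10–13.12 / §14.7, direction `δ = g = (0,0,0,0,1)`, side `L` (Zudilin's first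
tale), written on the pattern of cert-1's pilot `TwoTaleOmega.StepBL` (direction `b`).
INPUT: cert-2's telescoper of direction `g` — the packed coefficient tables `cG0..cG3` of
`Certificates.TwoTaleTelescopeGL` (fam-tele gen 3 certificate `certs/tele/bmiss_general/certificates.json`, direction `g`,
side `L`: `Cert_L = t(t+a−e)(t+a−f)(t+g+2)/((t+g)(t+g+1)(t+g+2))`, `x_L = 1`), decoded here into CLOSED FORMS
(`coefG_zero/one/two/three`, proved from the packed tables by `simp` + `ring`, so the coefficients are literally cert-2's
`tabAt (tabG k)` values, cf. `OmegaBridge.tabAt_cast`). The telescoping identity is used in its REDUCED form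
  `Z := c0·(t+g)(t+g+1)(t+g+2) + c1·(t+g+1)(t+g+2) + c2·(t+g+2) + c3 − (t+e)(t+f)(t+b)(t+a) + t(t+a−e)(t+a−f)(t+g+2) ≡ 0`,
checked by `ring` inside `funId_gL`; cert-2's cleared kernel identity `telescope_g_L` is `Z` multiplied by the non-zero
polynomial `(t+g)⁴(t+g+1)³(t+g+2)²·(t+1)(t+a−e+1)(t+a−f+1)(t+g+3)` and is not needed at that size (it stays the
machine-checked provenance of the tables). OUTPUT (`recL_g`): for a base point `p` with
`p, p+δ, p+2δ, p+3δ ∈ Ω`,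
  `Σ_{k<4} c^g_k(p) · Λ¹_{node(p+kδ)}[vL(p+kδ)] = 0`  and  `Σ_{k<4} c^g_k(p) · Λ⁰_{node(p+kδ)}[vL(p+kδ)] = 0`
(common truncation `D = d⁺ + 7`), i.e. the first-tale halves of `U1`, `U0` (`OmegaForms`) satisfy the telescoper's recurrence.
WHAT IS SPECIAL ABOUT `g` (fam-tele g5 `G-INSTANCE-PREP.md`): along `δ_g` only the upper parameter `b₄ = g` of the first tale
moves, so `F_L(p+kδ;t) = F_L(p;t)/((t+g)⋯(t+g+k−1))` (new poles far LEFT of the contour), the node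
`s* = 1 − a₂*(e,f,b,a)` is the SAME for all four points (no node moves at all), and the telescoped function is
`G = Cert_L·F_L(p;·) = block(0,e)·block(a−e,f)·block(a−f,b) / block(a,g+2)` — cert-1's `N_G` of direction `b` without its
factor `(t+g−1)`, over the pole range `[a, g+2)`. Legitimacy at `s*`: `ρ¹ = 0` (no pole) and `ρ⁰ = 0` (the same three-case
double zero of `N_G` as in `StepBL`). The leading coefficient is `c^g_3(p) = (f−g−2)(e−g−2)(b−g−2)(a−g−2) > 0` on Ω
(`coefG_three`, `coefG_three_pos`); the trailing one is `c^g_0(p) = b+2e+2f−a−g−2 = Δ(p)+1` (`coefG_zero`, the layer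
coefficient of RECURRENCE.md §14.3).
-/

noncomputable section

open Finset Polynomial
open Literature.NumberTheory.Irrationality.Zudilin2014
open Summit.KontsevichZagierPeriods.Zeta5Search.FormalBarnes
open Summit.KontsevichZagierPeriods.Zeta5Search.Certificates.TwoTaleTelescope

namespace Summit.KontsevichZagierPeriods.Zeta5Search.TwoTaleOmega

namespace Pt

variable (p : Pt)

/-! ### The telescoper of direction `g` at a point -/

/-- cert-2's telescoper coefficients `c^g_0..c^g_3` of direction `g`, evaluated at `p` (packed data of
`Certificates.TwoTaleTelescopeGL`). -/
def coefG : Fin 4 → ℚ :=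
  ![spvalC Certificates.TwoTaleTelescope.cG0 (p.a : ℚ) p.b p.e p.f p.g, spvalC Certificates.TwoTaleTelescope.cG1 (p.a : ℚ) p.b p.e p.f p.g,
    spvalC Certificates.TwoTaleTelescope.cG2 (p.a : ℚ) p.b p.e p.f p.g, spvalC Certificates.TwoTaleTelescope.cG3 (p.a : ℚ) p.b p.e p.f p.g]

/-- The trailing coefficient in closed form: `c^g_0(p) = b + 2e + 2f − a − g − 2 = Δ(p) + 1`. -/
theorem coefG_zero : p.coefG 0 = p.b + 2 * p.e + 2 * p.f - p.a - p.g - 2 := by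
  simp [coefG, Certificates.TwoTaleTelescope.cG0, spvalC, spvalN, spval, unpackT]; ring

/-- `c^g_1(p)` in closed form (decoded from cert-2's packed table `cG1`, 17 monomials). -/
theorem coefG_one : p.coefG 1 = -(p.a : ℚ) ^ 2 + p.a * p.b + 2 * p.a * p.e + 2 * p.a * p.f + p.a * p.g - p.a + p.b * p.e
    + p.b * p.f - 3 * p.b * p.g - 3 * p.b - 5 * p.e * p.g - 4 * p.e - 5 * p.f * p.g - 4 * p.f + 3 * p.g ^ 2 + 9 * p.g + 6 := by
  simp [coefG, Certificates.TwoTaleTelescope.cG1, spvalC, spvalN, spval, unpackT]; ring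

/-- `c^g_2(p)` in closed form (decoded from cert-2's packed table `cG2`, 34 monomials). -/
theorem coefG_two : p.coefG 2 = (p.a : ℚ) ^ 2 * p.g + p.a ^ 2 + p.a * p.b * p.e + p.a * p.b * p.f - 2 * p.a * p.b * p.g
    - 3 * p.a * p.b + p.a * p.e * p.f - 3 * p.a * p.e * p.g - 4 * p.a * p.e - 3 * p.a * p.f * p.g - 4 * p.a * p.f + p.a * p.g ^ 2
    + 5 * p.a * p.g + 5 * p.a + p.b * p.e * p.f - 2 * p.b * p.e * p.g - 3 * p.b * p.e - 2 * p.b * p.f * p.g - 3 * p.b * p.f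
    + 3 * p.b * p.g ^ 2 + 9 * p.b * p.g + 7 * p.b - p.e * p.f * p.g - 2 * p.e * p.f + 4 * p.e * p.g ^ 2 + 11 * p.e * p.g + 8 * p.e
    + 4 * p.f * p.g ^ 2 + 11 * p.f * p.g + 8 * p.f - 3 * p.g ^ 3 - 15 * p.g ^ 2 - 25 * p.g - 14 := by
  simp [coefG, Certificates.TwoTaleTelescope.cG2, spvalC, spvalN, spval, unpackT]; ring

/-- The leading coefficient in closed form: `c^g_3(p) = (f−g−2)(e−g−2)(b−g−2)(a−g−2)`. -/
theorem coefG_three : p.coefG 3 = (p.f - p.g - 2) * (p.e - p.g - 2) * (p.b - p.g - 2) * (p.a - p.g - 2) := by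
  simp [coefG, Certificates.TwoTaleTelescope.cG3, spvalC, spvalN, spval, unpackT]; ring

variable {p}

/-- On Ω every factor of `c^g_3` is `≤ −3`, so the leading coefficient is positive, in particular non-zero. -/
theorem coefG_three_pos (h : p.Omega) : 0 < p.coefG 3 := by
  rw [coefG_three]
  obtain ⟨h1, h2, h3, h4, h5, h6, h7, h8, h9⟩ := h
  have ha : (3 : ℚ) ≤ (p.g : ℚ) + 2 - p.a := by exact_mod_cast (by omega : (3 : ℤ) ≤ p.g + 2 - p.a)
  have hb : (3 : ℚ) ≤ (p.g : ℚ) + 2 - p.b := by exact_mod_cast (by omega : (3 : ℤ) ≤ p.g + 2 - p.b)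
  have he : (3 : ℚ) ≤ (p.g : ℚ) + 2 - p.e := by exact_mod_cast (by omega : (3 : ℤ) ≤ p.g + 2 - p.e)
  have hf : (3 : ℚ) ≤ (p.g : ℚ) + 2 - p.f := by exact_mod_cast (by omega : (3 : ℤ) ≤ p.g + 2 - p.f)
  have e1 : ((p.f : ℚ) - p.g - 2) * (p.e - p.g - 2) * (p.b - p.g - 2) * (p.a - p.g - 2)
      = ((p.g + 2 - p.f) * (p.g + 2 - p.e)) * ((p.g + 2 - p.b) * (p.g + 2 - p.a)) := by ring
  rw [e1]
  exact mul_pos (mul_pos (by linarith) (by linarith)) (mul_pos (by linarith) (by linarith))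

/-- The certificate numerator `x_L` of direction `g` is the constant `1`. -/
theorem xGL_eval (s : ℤ) (a b e f g t : ℚ) : polyTN xGL s a b e f g t = 1 := by
  simp [polyTN, xGL, spvalC, spvalN, spval, unpackT]

/-! ### Block algebra along `δ_g` -/

variable (p)

/-- Along `δ_g` the numerator of the first-tale integrand does not move (`g` is the upper parameter `b₄`). -/
theorem num_addG_eq (k : ℤ) : num (p.addG k).t1a (p.addG k).t1b = num p.t1a p.t1b := by
  rw [num_t1, num_t1]; simp only [addG_a, addG_b, addG_e, addG_f]

/-- Along `δ_g` the denominator block grows: `den(p+kδ_g) = block(a, g+k)`. -/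
theorem den_addG_eq (k : ℤ) : den (p.addG k).t1a (p.addG k).t1b = block p.a (p.g + k) := by
  rw [den_t1]; simp only [addG_a, addG_g]

/-- `block a (g+k) = block a g · block g (g+k)` (`p ∈ Ω`, `k ≥ 0`). -/
theorem block_addG (h : p.Omega) {k : ℤ} (hk : 0 ≤ k) : block p.a (p.g + k) = block p.a p.g * block p.g (p.g + k) := by
  have := h.a_lt_g
  rw [block_mul_block (lo := p.a) (mi := p.g) (hi := p.g + k) (by omega) (by omega)]

/-- `block a (g+3) = block a (g+2) · (t+g+2)`. -/
theorem block_addG_three_split (h : p.Omega) : block p.a (p.g + 3) = block p.a (p.g + 2) * lin (p.g + 2) := by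
  have := h.a_lt_g
  rw [show p.g + 3 = p.g + 2 + 1 by ring, ← block_mul_block (lo := p.a) (mi := p.g + 2) (hi := p.g + 2 + 1) (by omega)
    (by omega), block_single]

/-! ### The telescoped function `G = Cert_L · F_L(p;·)` as closed-form data -/

/-- Numerator of `G`: `t(t+a−e)(t+a−f)·num = block(0,e)·block(a−e,f)·block(a−f,b)` (merged blocks). -/
def NfGL : ℚ[X] := block 0 p.e * block (p.a - p.e) p.f * block (p.a - p.f) p.b

/-- The merged form equals `Cert_L`'s `t`-dependent numerator factors times `num` (on Ω the blocks are non-empty). -/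
theorem NfGL_eq (h : p.Omega) : p.NfGL = lin 0 * lin (p.a - p.e) * lin (p.a - p.f) * num p.t1a p.t1b := by
  obtain ⟨h1, h2, h3, h4, h5, h6, h7, h8, h9⟩ := h
  rw [num_t1, NfGL, block_succ_left (lo := 0) (hi := p.e) (by omega),
    block_succ_left (lo := p.a - p.e) (hi := p.f) (by omega), block_succ_left (lo := p.a - p.f) (hi := p.b) (by omega)]
  ring_nf

/-- Degree of `N_G`: `e + (f−a+e) + (b−a+f)`. -/
theorem natDegree_NfGL : p.NfGL.natDegree = (p.e).toNat + (p.f - (p.a - p.e)).toNat + (p.b - (p.a - p.f)).toNat := by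
  unfold NfGL
  rw [natDegree_mul (mul_ne_zero (block_ne_zero _ _) (block_ne_zero _ _)) (block_ne_zero _ _),
    natDegree_mul (block_ne_zero _ _) (block_ne_zero _ _), natDegree_block, natDegree_block, natDegree_block, sub_zero]

/-- **The telescoped data** `G_{g,L}(p) = ofFrac [a,g+2) 1 (N_G)`. -/
def GfGL : PF := PF.ofFrac (Ico p.a (p.g + 2)) (fun _ => 1) p.NfGL

/-- The poles of `G_{g,L}` lie in `[a,g+2)`. -/
theorem poles_GfGL : p.GfGL.poles ⊆ Ico p.a (p.g + 2) := PF.poles_ofFrac _ _ _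

/-- Value of `G_{g,L}`: `t(t+a−e)(t+a−f)·num(t)/block(a,g+2)(t)` off the poles. -/
theorem GfGL_eval (h : p.Omega) {t : ℚ} (ht : ∀ k ∈ Ico p.a (p.g + 2), t + k ≠ 0) :
    p.GfGL.eval t = t * (t + (p.a - p.e : ℤ)) * (t + (p.a - p.f : ℤ))
      * ((num p.t1a p.t1b).eval t / (block p.a (p.g + 2)).eval t) := by
  unfold GfGL
  rw [PF.eval_ofFrac _ _ _ (fun _ _ => Or.inl rfl) ht, denom_Ico_one, NfGL_eq p h]
  simp only [eval_mul, eval_lin]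
  push_cast; ring

/-- Degree of the polynomial part of `G_{g,L}`: `d + 1 ≤ d⁺ + 7`. -/
theorem natDegree_GfGL_le (h : p.Omega) : p.GfGL.poly.natDegree ≤ dExp p.t1a p.t1b + 7 := by
  unfold GfGL
  rw [PF.natDegree_ofFrac, natDegree_NfGL p, sum_const, Int.card_Ico, smul_eq_mul, mul_one]
  unfold dExp; rw [sum_t1a_sub_sum_t1b]; unfold dInt
  obtain ⟨h1, h2, h3, h4, h5, h6, h7, h8, h9⟩ := h
  omega

/-! ### Step (2): the function identity -/

/-- The exceptional set for Lemma U: the poles of both sides and of the shifted data (`[a−1, g+3]`), and the zeros of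
the shift denominators. -/
def SgL : Finset ℤ := Ico (p.a - 1) (p.g + 4) ∪ {1, p.a - p.e + 1, p.a - p.f + 1}

variable {p}

set_option maxHeartbeats 800000 in
/-- **Function identity** `Σ_k c^g_k(p) F_L(p+kδ;t) = G(t+1) − G(t)` off the exceptional set. All four values and both
values of `G` are polynomial multiples of `W = F_L(p+3δ;t)` and `W' = F_L(p+3δ;t+1)`, which are tied by the shift law of
`p+3δ` (`G(t+1) = (t+1)(t+a−e+1)(t+a−f+1)(t+g+3)·W' = (t+e)(t+f)(t+b)(t+a)·W`); what is left is the reduced identity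
`W·Z = 0`, `Z ≡ 0` by `ring` on the closed forms of the coefficients. -/
theorem funId_gL (h0 : p.Omega) (h1 : (p.addG 1).Omega) (h2 : (p.addG 2).Omega) (h3 : (p.addG 3).Omega) {t : ℚ}
    (ht : ∀ k ∈ p.SgL, t + k ≠ 0) :
    p.coefG 0 * p.vL.eval t + p.coefG 1 * (p.addG 1).vL.eval t + p.coefG 2 * (p.addG 2).vL.eval t
      + p.coefG 3 * (p.addG 3).vL.eval t = p.GfGL.eval (t + 1) - p.GfGL.eval t := by
  have o := h0
  obtain ⟨o1, o2, o3, o4, o5, o6, o7, o8, o9⟩ := h0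
  -- non-vanishing off the exceptional set
  have hI : ∀ k : ℤ, p.a - 1 ≤ k → k < p.g + 4 → t + (k : ℚ) ≠ 0 := fun k hk1 hk2 =>
    ht k (by unfold SgL; rw [mem_union]; left; rw [mem_Ico]; exact ⟨hk1, hk2⟩)
  have hlin : ∀ c : ℚ, ∀ k : ℤ, p.a - 1 ≤ k → k < p.g + 4 → c = t + (k : ℚ) → c ≠ 0 :=
    fun c k hk1 hk2 hc => by rw [hc]; exact hI k hk1 hk2
  have hS0 : ∀ k ∈ Ico p.a p.g, t + (k : ℚ) ≠ 0 := fun k hk => by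
    rw [mem_Ico] at hk; exact hI k (by omega) (by omega)
  have hS1 : ∀ k ∈ Ico (p.addG 1).a (p.addG 1).g, t + (k : ℚ) ≠ 0 := fun k hk => by
    simp only [addG_a, addG_g, mem_Ico] at hk; exact hI k (by omega) (by omega)
  have hS2 : ∀ k ∈ Ico (p.addG 2).a (p.addG 2).g, t + (k : ℚ) ≠ 0 := fun k hk => by
    simp only [addG_a, addG_g, mem_Ico] at hk; exact hI k (by omega) (by omega)
  have hS3 : ∀ k ∈ Ico (p.addG 3).a (p.addG 3).g, t + (k : ℚ) ≠ 0 := fun k hk => by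
    simp only [addG_a, addG_g, mem_Ico] at hk; exact hI k (by omega) (by omega)
  have hS3' : ∀ k ∈ Ico (p.addG 3).a (p.addG 3).g, t + 1 + (k : ℚ) ≠ 0 := fun k hk => by
    simp only [addG_a, addG_g, mem_Ico] at hk
    have := hI (k + 1) (by omega) (by omega)
    push_cast at this
    rwa [add_assoc, add_comm (1:ℚ)]
  have hG2 : ∀ k ∈ Ico p.a (p.g + 2), t + (k : ℚ) ≠ 0 := fun k hk => by
    rw [mem_Ico] at hk; exact hI k (by omega) (by omega)
  have hG2' : ∀ k ∈ Ico p.a (p.g + 2), t + 1 + (k : ℚ) ≠ 0 := fun k hk => by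
    rw [mem_Ico] at hk
    have := hI (k + 1) (by omega) (by omega)
    push_cast at this
    rwa [add_assoc, add_comm (1:ℚ)]
  have hg0 : t + p.g ≠ 0 := hlin _ p.g (by omega) (by omega) (by norm_num)
  have hg1 : t + p.g + 1 ≠ 0 := hlin _ (p.g + 1) (by omega) (by omega) (by push_cast; ring)
  have hg2 : t + p.g + 2 ≠ 0 := hlin _ (p.g + 2) (by omega) (by omega) (by push_cast; ring)
  have hD0 : (block p.a p.g).eval t ≠ 0 := eval_block_ne_zero fun i hi h => hS0 i hi (by rw [h]; ring)
  have hD2' : (block p.a (p.g + 2)).eval (t + 1) ≠ 0 := eval_block_ne_zero fun i hi h => hG2' i hi (by rw [h]; ring)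
  have hP3 : (t + p.g) * (t + p.g + 1) * (t + p.g + 2) ≠ 0 := mul_ne_zero (mul_ne_zero hg0 hg1) hg2
  -- the denominator blocks along δ_g
  have e123 := eval_block_123 p.g t
  have hb1 : (block p.a (p.g + 1)).eval t = (block p.a p.g).eval t * (t + p.g) := by
    rw [block_addG p o (k := 1) (by norm_num), eval_mul, e123.1]
  have hb2 : (block p.a (p.g + 2)).eval t = (block p.a p.g).eval t * ((t + p.g) * (t + p.g + 1)) := by
    rw [block_addG p o (k := 2) (by norm_num), eval_mul, e123.2.1]
  have hb3 : (block p.a (p.g + 3)).eval t = (block p.a p.g).eval t * ((t + p.g) * (t + p.g + 1) * (t + p.g + 2)) := by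
    rw [block_addG p o (k := 3) (by norm_num), eval_mul, e123.2.2]
  have hb3' : (block p.a (p.g + 3)).eval (t + 1) = (block p.a (p.g + 2)).eval (t + 1) * (t + 1 + (p.g + 2 : ℤ)) := by
    rw [block_addG_three_split p o, eval_mul, eval_lin]
  -- the base value W = F_L(p+3δ;t) and everything in terms of it
  have eW : (p.addG 3).vL.eval t
      = (num p.t1a p.t1b).eval t / ((block p.a p.g).eval t * ((t + p.g) * (t + p.g + 1) * (t + p.g + 2))) := by
    rw [vL_eval_w h3 hS3, num_addG_eq, den_addG_eq, hb3]
  have eF0 : p.vL.eval t = (p.addG 3).vL.eval t * ((t + p.g) * (t + p.g + 1) * (t + p.g + 2)) := by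
    rw [eW, vL_eval_w o hS0, den_t1, div_mul_eq_mul_div, mul_div_mul_right _ _ hP3]
  have eF1 : (p.addG 1).vL.eval t = (p.addG 3).vL.eval t * ((t + p.g + 1) * (t + p.g + 2)) := by
    rw [eW, vL_eval_w h1 hS1, num_addG_eq, den_addG_eq, hb1, div_mul_eq_mul_div,
      div_eq_div_iff (mul_ne_zero hD0 hg0) (mul_ne_zero hD0 hP3)]
    ring
  have eF2 : (p.addG 2).vL.eval t = (p.addG 3).vL.eval t * (t + p.g + 2) := by
    rw [eW, vL_eval_w h2 hS2, num_addG_eq, den_addG_eq, hb2, div_mul_eq_mul_div,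
      div_eq_div_iff (mul_ne_zero hD0 (mul_ne_zero hg0 hg1)) (mul_ne_zero hD0 hP3)]
    ring
  have eG0 : p.GfGL.eval t
      = t * (t + (p.a - p.e : ℤ)) * (t + (p.a - p.f : ℤ)) * (t + p.g + 2) * (p.addG 3).vL.eval t := by
    have q0 : (num p.t1a p.t1b).eval t / ((block p.a p.g).eval t * ((t + p.g) * (t + p.g + 1)))
        = (num p.t1a p.t1b).eval t / ((block p.a p.g).eval t * ((t + p.g) * (t + p.g + 1) * (t + p.g + 2)))
          * (t + p.g + 2) := by
      rw [div_mul_eq_mul_div, div_eq_div_iff (mul_ne_zero hD0 (mul_ne_zero hg0 hg1)) (mul_ne_zero hD0 hP3)]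
      ring
    rw [GfGL_eval p o hG2, hb2, q0, eW]
    ring
  have eG1 : p.GfGL.eval (t + 1) = (t + 1) * (t + 1 + (p.a - p.e : ℤ)) * (t + 1 + (p.a - p.f : ℤ))
      * (t + 1 + (p.g + 2 : ℤ)) * (p.addG 3).vL.eval (t + 1) := by
    have hw : (p.addG 3).vL.eval (t + 1)
        = (num p.t1a p.t1b).eval (t + 1) / ((block p.a (p.g + 2)).eval (t + 1) * (t + 1 + (p.g + 2 : ℤ))) := by
      rw [vL_eval_w h3 hS3', num_addG_eq, den_addG_eq, hb3']
    have hq : (t + 1 + (p.g + 2 : ℤ) : ℚ) ≠ 0 := hlin _ (p.g + 3) (by omega) (by omega) (by push_cast; ring)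
    have q1 : (num p.t1a p.t1b).eval (t + 1) / (block p.a (p.g + 2)).eval (t + 1)
        = (t + 1 + (p.g + 2 : ℤ)) * ((num p.t1a p.t1b).eval (t + 1)
            / ((block p.a (p.g + 2)).eval (t + 1) * (t + 1 + (p.g + 2 : ℤ)))) := by
      rw [mul_div_assoc', div_eq_div_iff hD2' (mul_ne_zero hD2' hq)]
      ring
    rw [GfGL_eval p o hG2', q1, ← hw]
    ring
  -- the shift law of p+3δ ties W' to W
  have hshift := vL_shift h3 hS3 hS3'
  simp only [addG_a, addG_b, addG_e, addG_f, addG_g] at hshift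
  push_cast at hshift
  -- the reduced telescoping identity `Z ≡ 0` (module docstring) is checked by `ring` from the closed forms of `c^g_k`
  rw [coefG_zero, coefG_one, coefG_two, coefG_three, eF0, eF1, eF2, eG0, eG1]
  push_cast
  linear_combination (-1 : ℚ) * hshift

/-! ### Step (3): the DATA identity -/

/-- **Data identity** `Σ_k c^g_k(p)·vL(p+kδ) = S G − G` (Lemma U over the exceptional set `SgL`). -/
theorem dataId_gL (h0 : p.Omega) (h1 : (p.addG 1).Omega) (h2 : (p.addG 2).Omega) (h3 : (p.addG 3).Omega) :
    PF.comb4 p.coefG ![p.vL, (p.addG 1).vL, (p.addG 2).vL, (p.addG 3).vL] = p.GfGL.shift.add (p.GfGL.smul (-1)) := by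
  have hIco : Ico p.a (p.g + 2) ⊆ p.SgL := fun k hk => by
    unfold SgL; rw [mem_union]; left; rw [mem_Ico] at hk ⊢; omega
  have hvk : ∀ q : Pt, q.a = p.a → q.g ≤ p.g + 3 → q.vL.poles ⊆ p.SgL := fun q hqa hqg => by
    refine (poles_vL q).trans fun j hj => ?_
    rw [mem_Ico, amax_t1a_eq] at hj
    unfold SgL; rw [mem_union]; left; rw [mem_Ico]; omega
  refine PF.eq_of_eval_eq_on _ _ p.SgL ?_ ?_ fun t ht => ?_
  · refine (PF.poles_comb4_subset _ _).trans (union_subset (union_subset ?_ ?_) (union_subset ?_ ?_)) <;>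
      simp only [Matrix.cons_val_zero, Matrix.cons_val_one, Matrix.cons_val_two, Matrix.cons_val_three,
        Matrix.head_cons, Matrix.tail_cons]
    · exact hvk p rfl (by omega)
    · exact hvk _ rfl (by simp)
    · exact hvk _ rfl (by simp)
    · exact hvk _ rfl (by simp)
  · refine (PF.poles_shift_sub_subset _).trans (union_subset ?_ ((poles_GfGL p).trans hIco))
    intro k hk
    obtain ⟨j, hj, rfl⟩ := mem_image.1 hk
    have hj' := poles_GfGL p hj
    unfold SgL; rw [mem_union]; left; rw [mem_Ico] at hj' ⊢; omega
  · rw [PF.eval_comb4, PF.eval_shift_sub, Fin.sum_univ_four]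
    simp only [Matrix.cons_val_zero, Matrix.cons_val_one, Matrix.cons_val_two, Matrix.cons_val_three,
      Matrix.head_cons, Matrix.tail_cons]
    exact funId_gL h0 h1 h2 h3 ht

/-! ### Step (4): legitimacy at the common node `s* = node(p)` -/

/-- The common node is not a pole and `N_G` has a double zero there: `ρ⁰_{s*}(G) = ρ¹_{s*}(G) = 0`. -/
theorem GfGL_rho (h : p.Omega) : rho0 p.nodeL p.GfGL = 0 ∧ rho1 p.nodeL p.GfGL = 0 := by
  have sp := a2star_t1a_eq h
  obtain ⟨o1, o2, o3, o4, o5, o6, o7, o8, o9⟩ := h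
  set m := a2star p.t1a with hm
  have hnode : p.nodeL = -(m - 1) := by unfold nodeL; ring
  have hc : m - 1 ∉ Ico p.a (p.g + 2) := by rw [mem_Ico]; omega
  rw [hnode]
  refine ⟨PF.rho0_ofFrac_eq_zero _ _ _ (fun _ _ => Or.inl rfl) hc ?_, PF.rho1_ofFrac_eq_zero _ _ _ hc⟩
  -- double zero of `N_G = block(0,e)·block(a−e,f)·block(a−f,b)` at `t = 1 − m`
  have hcases : (0 ≤ m - 1 ∧ m - 1 < p.e ∧ p.a - p.e ≤ m - 1 ∧ m - 1 < p.f)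
      ∨ (0 ≤ m - 1 ∧ m - 1 < p.e ∧ p.a - p.f ≤ m - 1 ∧ m - 1 < p.b)
      ∨ (p.a - p.e ≤ m - 1 ∧ m - 1 < p.f ∧ p.a - p.f ≤ m - 1 ∧ m - 1 < p.b) := by omega
  unfold NfGL
  rcases hcases with ⟨a1, a2, a3, a4⟩ | ⟨a1, a2, a3, a4⟩ | ⟨a1, a2, a3, a4⟩
  · exact (pow_two (lin (m - 1)) ▸ mul_dvd_mul (lin_dvd_block a1 a2) (lin_dvd_block a3 a4)).mul_right _
  · refine (pow_two (lin (m - 1)) ▸ mul_dvd_mul (lin_dvd_block a1 a2) (lin_dvd_block a3 a4)).trans ?_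
    exact ⟨block (p.a - p.e) p.f, by ring⟩
  · refine (pow_two (lin (m - 1)) ▸ mul_dvd_mul (lin_dvd_block a1 a2) (lin_dvd_block a3 a4)).trans ?_
    exact ⟨block 0 p.e, by ring⟩

/-! ### Step (5): no node moves — the node is `g`-free -/

/-- Along `δ_g` the first-tale node does not move: `node(p+kδ_g) = node(p)` (`a₂*(e,f,b,a)` does not involve `g`). -/
theorem nodeL_addG (k : ℤ) : (p.addG k).nodeL = p.nodeL := rfl

/-! ### Step (6): the first-tale recurrence of direction `g` -/

/-- **Direction `g`, first tale.** For `p, p+δ, p+2δ, p+3δ ∈ Ω` (`δ = δ_g`), the first-tale functionals at their own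
nodes satisfy cert-2's telescoper: `Σ_k c^g_k(p)·Λ¹_{node(p+kδ)}[vL(p+kδ)] = 0` and the same for `Λ⁰` with the common
truncation `D = d⁺(p) + 7`. -/
theorem recL_g (h0 : p.Omega) (h1 : (p.addG 1).Omega) (h2 : (p.addG 2).Omega) (h3 : (p.addG 3).Omega) :
    (p.coefG 0 * lam1 p.nodeL p.vL + p.coefG 1 * lam1 (p.addG 1).nodeL (p.addG 1).vL
      + p.coefG 2 * lam1 (p.addG 2).nodeL (p.addG 2).vL + p.coefG 3 * lam1 (p.addG 3).nodeL (p.addG 3).vL = 0) ∧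
    (p.coefG 0 * lam0 (dExp p.t1a p.t1b + 7) p.nodeL p.vL
      + p.coefG 1 * lam0 (dExp p.t1a p.t1b + 7) (p.addG 1).nodeL (p.addG 1).vL
      + p.coefG 2 * lam0 (dExp p.t1a p.t1b + 7) (p.addG 2).nodeL (p.addG 2).vL
      + p.coefG 3 * lam0 (dExp p.t1a p.t1b + 7) (p.addG 3).nodeL (p.addG 3).vL = 0) := by
  have hdata := dataId_gL h0 h1 h2 h3
  have hrho := GfGL_rho h0
  have s1 := lam1_step p.nodeL p.coefG _ p.GfGL hdata
  have s0 := lam0_step (dExp p.t1a p.t1b + 7) p.nodeL p.coefG _ p.GfGL hdata (natDegree_GfGL_le p h0)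
  rw [Fin.sum_univ_four] at s1 s0
  simp only [Matrix.cons_val_zero, Matrix.cons_val_one, Matrix.cons_val_two, Matrix.cons_val_three,
    Matrix.head_cons, Matrix.tail_cons] at s1 s0
  rw [hrho.2] at s1
  rw [hrho.1] at s0
  simp only [nodeL_addG]
  exact ⟨s1, s0⟩

end Pt

end Summit.KontsevichZagierPeriods.Zeta5Search.TwoTaleOmega

end
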